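import Literature.Analysis.FluidPDE.SteadyNavierStokesRegularity
import Summits.AnomalousDissipation.AnomalousDissipation.Theorems.BaireTransferRobustLoudUpgradeLine

/-!
# Stub `stub_driftRegularity` of the line `malkin-cone-group-orbits`
# (crux stmt-AnomalousDissipation-1144, lead c15, wave 3):
# regularity of DRIFTED steady weak solutions of the Navier–Stokes equations on `T³`

A classical steady state of `NS_ν(f)` on `T³` of ANY mean `m` is `m + w` with `w` mean-zero solving
the drifted steady equation `νΔw − (w·∇)w − (m·∇)w − ∇p + f = 0`; its weak form for `W ∈ H` is
`⟨F(W), φ⟩ + ∫ ⟪Dφ(x) m, W(x)⟫ dx = 0` for all `φ ∈ 𝒱` (`Torus.nsGeneratorPairing`, all derivatives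
on the test field).  THIS FILE: for `ν > 0`, a smooth force `f`, a constant drift `m ∈ ℝ³` and a
drifted steady weak solution `W ∈ V`, the velocity `W` is a.e. equal to a `C^∞` field
(`Category.stub_driftRegularity`) — Temam 1979, Ch. II Prop. 1.1 with a constant drift.

## Proof

Verbatim the Fourier-lattice bootstrap of
`Literature/Analysis/FluidPDE/SteadyNavierStokesRegularity.lean` (namespace
`Literature.Analysis.FluidPDE.SteadyNS`), whose abstract parts — the lattice bootstrap
`SteadyNS.tsum_weight_mul_ne_top` and the Fourier synthesis of the smooth representative — are
reused by name.  Only the tested single-mode identity changes: testing the drifted formulation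
against the real mode `a = Re (e_k z)` (`k ≠ 0`, `k · z = 0`, so `a ∈ 𝒱`) adds the drift term
`∫ ⟪Da(x) m, W(x)⟫ dx = ∑ⱼ mⱼ Re ⟪Ŵ(k), 2πi kⱼ z⟫_ℂ` (`DriftReg.driftPairing_realTrigPoly_singleton`,
from `Da(x) m = ∑ⱼ mⱼ ∂ⱼa(x)`, `∂ⱼ Re (e_k z) = Re (e_k 2πi kⱼ z)` and
`∫ ⟪W, Re (e_k z')⟫ = Re ⟪Ŵ(k), z'⟫`), giving
`4π²ν|k|² Re⟪Ŵ(k), z⟫ = Re⟪f̂(k), z⟫ + ∫ ⟪Da W, W⟫ + ∑ⱼ mⱼ Re (2πi kⱼ ⟪Ŵ(k), z⟫)`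
(`DriftReg.tested_singleMode_drift`).  For the transversal unit vector `z = Ŵ(k)/‖Ŵ(k)‖`
(`DriftReg.exists_transversal_unit_inner_eq`) the inner product `⟪Ŵ(k), z⟫ = ‖Ŵ(k)‖` is REAL, so
every `Re (2πi kⱼ ‖Ŵ(k)‖)` vanishes: the drift term drops out and the coefficient inequality
`⟨k⟩² ‖Ŵ(k)‖ ≤ C_{ν,d} (‖f̂(k)‖ + ⟨k⟩ ∑_l ‖Ŵ(k - l)‖ ‖Ŵ(l)‖)` holds with the undrifted constant
(`DriftReg.weight_two_mul_enorm_coeff_le_drift`, a copy of `SteadyNS.weight_two_mul_enorm_coeff_le`).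
The lattice bootstrap (`#d ≤ 3`, `W ∈ V`) then gives rapid decay of `Ŵ`, and the real part of the
Fourier synthesis is the smooth representative, exactly as in
`Torus.Temam1979_steadyWeakSolution_smooth_holds`.

## References

* R. Temam, *Navier–Stokes Equations: Theory and Numerical Analysis*, North-Holland (1979),
  Ch. II §1, Prop. 1.1 (regularity of stationary weak solutions, `n ≤ 3`). [Temam1979]
* P. Constantin, C. Foias, *Navier–Stokes Equations*, Univ. Chicago Press (1988), Ch. 7,
  (7.10)–(7.11); Ch. 4 (4.13) (transversality `k · û(k) = 0`).
-/

-- `Summit.<Summit>.<Problem>` is the tree's mandated summit-side namespace (CONVENTIONS §2); for this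
-- single-conjunct summit the two coincide, so the duplicate is deliberate.
set_option linter.dupNamespace false

noncomputable section

open scoped BigOperators Topology InnerProductSpace RealInnerProductSpace ENNReal
open Filter Set Function TopologicalSpace MeasureTheory

namespace Summit.AnomalousDissipation.AnomalousDissipation.Theorems.RobustLoudUpgrade.Category

open Literature.Analysis.FunctionSpaces Literature.Analysis.FunctionSpaces.Torus
open Literature.Analysis.FluidPDE Literature.Analysis.FluidPDE.Torus
open UnitAddTorus

/-! ## §1 The drifted single-mode identity and the coefficient inequality (general `d`) -/

namespace DriftReg

variable {d : Type*} [Fintype d] [DecidableEq d]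

/-- **The drift pairing against a single real mode** `a = Re (e_k z)`:
`∫ ⟪Da(x) m, v(x)⟫ dx = ∑ⱼ mⱼ Re ⟪v̂(k), 2πi kⱼ z⟫_ℂ` (`Da(x) m = ∑ⱼ mⱼ ∂ⱼa(x)`,
`∂ⱼ Re (e_k z) = Re (e_k 2πi kⱼ z)`, and `∫ ⟪v, Re (e_k z')⟫ = Re ⟪v̂(k), z'⟫`). [folklore] -/
theorem driftPairing_realTrigPoly_singleton
    (v : Lp (EuclideanSpace ℝ d) 2 (volume : Measure (UnitAddTorus d))) (k : d → ℤ)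
    (z : EuclideanSpace ℂ d) (m : EuclideanSpace ℝ d) :
    ∫ x, ⟪Torus.fderiv (realTrigPoly {k} fun _ => z) x m,
        (v : UnitAddTorus d → EuclideanSpace ℝ d) x⟫_ℝ =
      ∑ j, m j * (inner ℂ (mFourierCoeff (EuclideanSpace.complexify ∘
        (v : UnitAddTorus d → EuclideanSpace ℝ d)) k)
          ((2 * Real.pi * Complex.I * (k j : ℂ)) • z)).re := by
  set V : UnitAddTorus d → EuclideanSpace ℝ d := (v : UnitAddTorus d → EuclideanSpace ℝ d) with hV
  have hVi : Integrable V volume := (Lp.memLp v).integrable one_le_two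
  set a : UnitAddTorus d → EuclideanSpace ℝ d := realTrigPoly {k} fun _ => z with ha
  have ha1 : IsContDiff 1 a := (isSmooth_realTrigPoly _ _).isContDiff (by simp)
  -- the `j`-th partial derivative of the mode is again a mode
  set cj : d → (d → ℤ) → EuclideanSpace ℂ d :=
    fun j k' => (2 * Real.pi * Complex.I * (k' j : ℂ)) • z with hcj
  have hpd : ∀ (j : d) x, Torus.partialDeriv j a x = realTrigPoly {k} (cj j) x := fun j x => by
    rw [ha, partialDeriv_realTrigPoly]
  -- pointwise expansion of the integrand
  have hpt : ∀ x, ⟪Torus.fderiv a x m, V x⟫_ℝ = ∑ j, m j * ⟪V x, realTrigPoly {k} (cj j) x⟫_ℝ := by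
    intro x
    rw [fderiv_apply_eq_sum_partialDeriv ha1 x m, sum_inner]
    refine Finset.sum_congr rfl fun j _ => ?_
    rw [real_inner_smul_left, hpd, real_inner_comm]
  simp_rw [hpt]
  have hint : ∀ j, Integrable (fun x => ⟪V x, realTrigPoly {k} (cj j) x⟫_ℝ) volume := fun j =>
    integrable_inner_of_continuous hVi (continuous_realTrigPoly _ _)
  rw [integral_finsetSum _ fun j _ => (hint j).const_mul (m j)]
  refine Finset.sum_congr rfl fun j _ => ?_
  rw [integral_const_mul, integral_inner_realTrigPoly_singleton hVi k (cj j)]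

/-- **The drifted steady weak formulation tested against a single real mode**: for `u ∈ H` with
`⟨F(u), w⟩ + ∫ ⟪Dw m, u⟫ = 0` on `𝒱`, `k ≠ 0` and `z ⊥ k` (so that `a = Re (e_k z) ∈ 𝒱`),
`4π²ν|k|² Re⟪û(k), z⟫ = Re⟪f̂(k), z⟫ + ∫ ⟪Da u, u⟫ + ∑ⱼ mⱼ Re ⟪û(k), 2πi kⱼ z⟫`
(`(f, a) = Re⟪f̂(k), z⟫`, `(u, Δa) = -4π²|k|² Re⟪û(k), z⟫`; Temam 1979, Ch. II (1.8)/(2.12) in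
Fourier variables, with the constant drift `m`). [cite: Temam1979, Ch. II Prop. 1.1] -/
theorem tested_singleMode_drift {ν : ℝ} {m : EuclideanSpace ℝ d}
    {f : UnitAddTorus d → EuclideanSpace ℝ d} (hf : IsSmooth f) {u : energySpace d}
    (hu : ∀ w : UnitAddTorus d → EuclideanSpace ℝ d, IsSmooth w → IsDivFree w → HasZeroMean w →
      Torus.nsGeneratorPairing ν f u w +
        ∫ x, ⟪Torus.fderiv w x m,
          ((u : Lp (EuclideanSpace ℝ d) 2 (volume : Measure (UnitAddTorus d))) :
            UnitAddTorus d → EuclideanSpace ℝ d) x⟫_ℝ = 0)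
    {k : d → ℤ} (hk : k ≠ 0) {z : EuclideanSpace ℂ d} (hz : ∑ j, (k j : ℂ) * z j = 0) :
    ν * (4 * Real.pi ^ 2 * freqNormSq k) *
        (inner ℂ (mFourierCoeff (EuclideanSpace.complexify ∘
          ((u : Lp (EuclideanSpace ℝ d) 2 (volume : Measure (UnitAddTorus d))) :
            UnitAddTorus d → EuclideanSpace ℝ d)) k) z).re =
      (inner ℂ (mFourierCoeff (EuclideanSpace.complexify ∘ f) k) z).re +
        Torus.inertialPairing (u : Lp (EuclideanSpace ℝ d) 2 (volume : Measure (UnitAddTorus d)))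
          (realTrigPoly {k} fun _ => z) +
        ∑ j, m j * (inner ℂ (mFourierCoeff (EuclideanSpace.complexify ∘
          ((u : Lp (EuclideanSpace ℝ d) 2 (volume : Measure (UnitAddTorus d))) :
            UnitAddTorus d → EuclideanSpace ℝ d)) k)
          ((2 * Real.pi * Complex.I * (k j : ℂ)) • z)).re := by
  set V : UnitAddTorus d → EuclideanSpace ℝ d :=
    ((u : Lp (EuclideanSpace ℝ d) 2 (volume : Measure (UnitAddTorus d))) :
      UnitAddTorus d → EuclideanSpace ℝ d)
    with hV
  have hVi : Integrable V volume :=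
    (Lp.memLp (u : Lp (EuclideanSpace ℝ d) 2 (volume : Measure (UnitAddTorus d)))).integrable
      one_le_two
  set a : UnitAddTorus d → EuclideanSpace ℝ d := realTrigPoly {k} (fun _ => z) with ha
  have h0 := hu a (isSmooth_realTrigPoly _ _) (isDivFree_realTrigPoly_singleton hz)
    (SteadyNS.hasZeroMean_realTrigPoly_singleton hk _)
  have h1 : ∫ x, ⟪f x, a x⟫_ℝ = (inner ℂ (mFourierCoeff (EuclideanSpace.complexify ∘ f) k) z).re :=
    integral_inner_realTrigPoly_singleton hf.integrable k _
  have h2 : ∫ x, ⟪V x, Torus.laplacian a x⟫_ℝ =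
      -(4 * Real.pi ^ 2 * freqNormSq k) *
        (inner ℂ (mFourierCoeff (EuclideanSpace.complexify ∘ V) k) z).re := by
    have h : ∀ x, ⟪V x, Torus.laplacian a x⟫_ℝ =
        -(4 * Real.pi ^ 2 * freqNormSq k) * ⟪V x, a x⟫_ℝ := fun x => by
      rw [ha, laplacian_realTrigPoly_singleton, real_inner_smul_right]
    simp_rw [h, integral_const_mul]
    rw [integral_inner_realTrigPoly_singleton hVi k _]
  have h3 : Torus.nsGeneratorPairing ν f u a =
      (∫ x, ⟪f x, a x⟫_ℝ) + ν * (∫ x, ⟪V x, Torus.laplacian a x⟫_ℝ) +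
        Torus.inertialPairing (u : Lp (EuclideanSpace ℝ d) 2 (volume : Measure (UnitAddTorus d)))
          a := rfl
  have h4 := driftPairing_realTrigPoly_singleton
    (u : Lp (EuclideanSpace ℝ d) 2 (volume : Measure (UnitAddTorus d))) k z m
  rw [h3, h1, h2, h4] at h0
  linear_combination -h0

omit [Fintype d] [DecidableEq d] in
/-- A transversal unit vector recovering the norm as a COMPLEX inner product: for `v ∈ ℂ^d`,
`v ≠ 0`, transversal to `k`, the vector `z = ‖v‖⁻¹ v` is transversal, has norm one, and
`⟪v, z⟫_ℂ = ‖v‖` (a real number). [folklore] -/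
theorem exists_transversal_unit_inner_eq [Fintype d] {k : d → ℤ} {v : EuclideanSpace ℂ d}
    (hv : v ≠ 0) (hk : ∑ j, (k j : ℂ) * v j = 0) :
    ∃ z : EuclideanSpace ℂ d, (∑ j, (k j : ℂ) * z j = 0) ∧ ‖z‖ = 1 ∧
      inner ℂ v z = ((‖v‖ : ℝ) : ℂ) := by
  have hn : 0 < ‖v‖ := norm_pos_iff.2 hv
  refine ⟨((‖v‖⁻¹ : ℝ) : ℂ) • v, ?_, ?_, ?_⟩
  · have : ∑ j, (k j : ℂ) * (((‖v‖⁻¹ : ℝ) : ℂ) • v) j =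
        ((‖v‖⁻¹ : ℝ) : ℂ) * ∑ j, (k j : ℂ) * v j := by
      rw [Finset.mul_sum]
      refine Finset.sum_congr rfl fun j _ => ?_
      rw [PiLp.smul_apply, smul_eq_mul]
      ring
    rw [this, hk, mul_zero]
  · rw [norm_smul, Complex.norm_real, Real.norm_eq_abs, abs_of_pos (inv_pos.2 hn),
      inv_mul_cancel₀ hn.ne']
  · rw [inner_smul_right, inner_self_eq_norm_sq_to_K]
    have hn' : ((‖v‖ : ℝ) : ℂ) ≠ 0 := Complex.ofReal_ne_zero.2 hn.ne'
    change ((‖v‖⁻¹ : ℝ) : ℂ) * ((‖v‖ : ℝ) : ℂ) ^ 2 = ((‖v‖ : ℝ) : ℂ)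
    rw [Complex.ofReal_inv, sq, ← mul_assoc, inv_mul_cancel₀ hn', one_mul]

/-- **The coefficient inequality of a drifted steady weak solution** `u ∈ H` with smooth force,
constant drift `m` and `ν > 0`: with `û = 𝓕(complexify ∘ u)`,
`⟨k⟩² ‖û(k)‖ ≤ C_{ν,d} (‖f̂(k)‖ + ⟨k⟩ ∑_l ‖û(k - l)‖ ‖û(l)‖)` for every `k`,
`C_{ν,d} = (1 + 2π (#d)²)/(2π²ν)` — the same constant as without drift: testing against
`Re (e_k z)` with the transversal unit vector `z = û(k)/‖û(k)‖` makes `⟪û(k), z⟫ = ‖û(k)‖` real,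
so the drift term `∑ⱼ mⱼ Re (2πi kⱼ ‖û(k)‖)` vanishes (`û(0) = 0`, `⟨k⟩² ≤ 2|k|²` for `k ≠ 0`).
[cite: Temam1979, Ch. II Prop. 1.1] -/
theorem weight_two_mul_enorm_coeff_le_drift {ν : ℝ} (hν : 0 < ν) {m : EuclideanSpace ℝ d}
    {f : UnitAddTorus d → EuclideanSpace ℝ d} (hf : IsSmooth f) {u : energySpace d}
    (hu : ∀ w : UnitAddTorus d → EuclideanSpace ℝ d, IsSmooth w → IsDivFree w → HasZeroMean w →
      Torus.nsGeneratorPairing ν f u w +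
        ∫ x, ⟪Torus.fderiv w x m,
          ((u : Lp (EuclideanSpace ℝ d) 2 (volume : Measure (UnitAddTorus d))) :
            UnitAddTorus d → EuclideanSpace ℝ d) x⟫_ℝ = 0)
    (k : d → ℤ) :
    ENNReal.ofReal (sobolevWeight 2 k) *
        ‖mFourierCoeff (EuclideanSpace.complexify ∘
          ((u : Lp (EuclideanSpace ℝ d) 2 (volume : Measure (UnitAddTorus d))) :
            UnitAddTorus d → EuclideanSpace ℝ d)) k‖ₑ ≤
      ENNReal.ofReal ((1 + 2 * Real.pi * (Fintype.card d : ℝ) ^ 2) / (2 * Real.pi ^ 2 * ν)) *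
        (‖mFourierCoeff (EuclideanSpace.complexify ∘ f) k‖ₑ +
          ENNReal.ofReal (sobolevWeight 1 k) *
            ∑' l, ‖mFourierCoeff (EuclideanSpace.complexify ∘
                ((u : Lp (EuclideanSpace ℝ d) 2 (volume : Measure (UnitAddTorus d))) :
                  UnitAddTorus d → EuclideanSpace ℝ d)) (k - l)‖ₑ *
              ‖mFourierCoeff (EuclideanSpace.complexify ∘
                ((u : Lp (EuclideanSpace ℝ d) 2 (volume : Measure (UnitAddTorus d))) :
                  UnitAddTorus d → EuclideanSpace ℝ d)) l‖ₑ) := by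
  set V : UnitAddTorus d → EuclideanSpace ℝ d :=
    ((u : Lp (EuclideanSpace ℝ d) 2 (volume : Measure (UnitAddTorus d))) :
      UnitAddTorus d → EuclideanSpace ℝ d)
    with hV
  have hV2 : MemLp V 2 volume :=
    Lp.memLp (u : Lp (EuclideanSpace ℝ d) 2 (volume : Measure (UnitAddTorus d)))
  set c : (d → ℤ) → EuclideanSpace ℂ d := fun m => mFourierCoeff (EuclideanSpace.complexify ∘ V) m
    with hc
  set K : ℝ := (1 + 2 * Real.pi * (Fintype.card d : ℝ) ^ 2) / (2 * Real.pi ^ 2 * ν) with hK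
  show ENNReal.ofReal (sobolevWeight 2 k) * ‖c k‖ₑ ≤ ENNReal.ofReal K *
    (‖mFourierCoeff (EuclideanSpace.complexify ∘ f) k‖ₑ +
      ENNReal.ofReal (sobolevWeight 1 k) * ∑' l, ‖c (k - l)‖ₑ * ‖c l‖ₑ)
  -- trivial cases
  by_cases hk : k = 0
  · have h0 : c 0 = 0 := Torus.mFourierCoeff_complexify_coe_zero_of_mem u.2
    rw [hk, h0, enorm_zero, mul_zero]
    exact zero_le
  by_cases hck : c k = 0
  · rw [hck, enorm_zero, mul_zero]
    exact zero_le
  -- the transversal unit vector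
  have hT : ∑ j, (k j : ℂ) * c k j = 0 :=
    (Torus.isWeaklyDivFree_of_mem_energySpace u.2).sum_mul_mFourierCoeff_eq_zero hV2 k
  obtain ⟨z, hz, hz1, hzc⟩ := exists_transversal_unit_inner_eq hck hT
  -- the real inequality: the drift term vanishes since `⟪c k, z⟫ = ‖c k‖` is real
  have hid := tested_singleMode_drift hf hu hk hz
  have hdrift : ∑ j, m j * (inner ℂ (c k) ((2 * Real.pi * Complex.I * (k j : ℂ)) • z)).re = 0 := by
    refine Finset.sum_eq_zero fun j _ => ?_
    rw [inner_smul_right, hzc]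
    simp
  have hzre : (inner ℂ (c k) z).re = ‖c k‖ := by
    rw [hzc, Complex.ofReal_re]
  rw [hzre, hdrift, add_zero] at hid
  set P : d → d → ℝ := fun j i => ‖mFourierCoeff (fun x => ((V x j * V x i : ℝ) : ℂ)) k‖ with hP
  have hreal : ν * (4 * Real.pi ^ 2 * freqNormSq k) * ‖c k‖ ≤
      ‖mFourierCoeff (EuclideanSpace.complexify ∘ f) k‖ +
        ∑ j, ∑ i, 2 * Real.pi * |(k j : ℝ)| * P j i := by
    have hb1 : (inner ℂ (mFourierCoeff (EuclideanSpace.complexify ∘ f) k) z).re ≤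
        ‖mFourierCoeff (EuclideanSpace.complexify ∘ f) k‖ :=
      (Complex.re_le_norm _).trans ((norm_inner_le_norm _ _).trans (by rw [hz1, mul_one]))
    have hb2 := (le_abs_self _).trans (SteadyNS.abs_inertialPairing_realTrigPoly_singleton_le
      (u : Lp (EuclideanSpace ℝ d) 2 (volume : Measure (UnitAddTorus d))) k z)
    simp only [hz1, mul_one] at hb2
    linarith
  -- pass to `ℝ≥0∞`
  have hfk : 0 ≤ freqNormSq k := freqNormSq_nonneg k
  have hE1 : ENNReal.ofReal (ν * (4 * Real.pi ^ 2 * freqNormSq k)) * ‖c k‖ₑ ≤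
      ‖mFourierCoeff (EuclideanSpace.complexify ∘ f) k‖ₑ +
        ∑ j, ∑ i, ENNReal.ofReal (2 * Real.pi * |(k j : ℝ)|) * ‖mFourierCoeff
          (fun x => ((V x j * V x i : ℝ) : ℂ)) k‖ₑ := by
    have h := ENNReal.ofReal_le_ofReal hreal
    rw [ENNReal.ofReal_mul (by positivity), ofReal_norm, ENNReal.ofReal_add (norm_nonneg _)
      (Finset.sum_nonneg fun j _ => Finset.sum_nonneg fun i _ => by positivity), ofReal_norm,
      ENNReal.ofReal_sum_of_nonneg (fun j _ => Finset.sum_nonneg fun i _ => by positivity)] at h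
    refine h.trans (add_le_add le_rfl (Finset.sum_le_sum fun j _ => ?_))
    rw [ENNReal.ofReal_sum_of_nonneg (fun i _ => by positivity)]
    refine Finset.sum_le_sum fun i _ => ?_
    rw [ENNReal.ofReal_mul (by positivity), hP, ofReal_norm]
  -- the product bound and `|kⱼ| ≤ ⟨k⟩`
  have hkj : ∀ j, |(k j : ℝ)| ≤ sobolevWeight 1 k := fun j => by
    refine (abs_apply_le_sqrt_freqNormSq k j).trans ?_
    rw [sobolevWeight, Real.sqrt_eq_rpow]
    exact Real.rpow_le_rpow hfk (by linarith) (by norm_num)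
  have hE2 : ∑ j, ∑ i, ENNReal.ofReal (2 * Real.pi * |(k j : ℝ)|) * ‖mFourierCoeff
      (fun x => ((V x j * V x i : ℝ) : ℂ)) k‖ₑ ≤
      ENNReal.ofReal (2 * Real.pi * (Fintype.card d : ℝ) ^ 2 * sobolevWeight 1 k) *
        ∑' l, ‖c (k - l)‖ₑ * ‖c l‖ₑ := by
    calc ∑ j, ∑ i, ENNReal.ofReal (2 * Real.pi * |(k j : ℝ)|) * ‖mFourierCoeff
          (fun x => ((V x j * V x i : ℝ) : ℂ)) k‖ₑ
        ≤ ∑ _j : d, ∑ _i : d, ENNReal.ofReal (2 * Real.pi * sobolevWeight 1 k) *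
            ∑' l, ‖c (k - l)‖ₑ * ‖c l‖ₑ := by
          refine Finset.sum_le_sum fun j _ => Finset.sum_le_sum fun i _ => ?_
          exact mul_le_mul' (ENNReal.ofReal_le_ofReal (by nlinarith [hkj j, Real.pi_pos]))
            (SteadyNS.enorm_mFourierCoeff_mul_apply_le hV2 i j k)
      _ = ENNReal.ofReal (2 * Real.pi * (Fintype.card d : ℝ) ^ 2 * sobolevWeight 1 k) *
            ∑' l, ‖c (k - l)‖ₑ * ‖c l‖ₑ := by
          rw [Finset.sum_const, Finset.sum_const, Finset.card_univ, nsmul_eq_mul, nsmul_eq_mul,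
            ← mul_assoc, ← mul_assoc]
          congr 1
          rw [← ENNReal.ofReal_natCast, ← ENNReal.ofReal_mul (Nat.cast_nonneg _),
            ← ENNReal.ofReal_mul (by positivity)]
          congr 1
          ring
  -- `⟨k⟩² ≤ 2 |k|²` for `k ≠ 0`
  have hw2 : sobolevWeight 2 k ≤
      (1 / (2 * Real.pi ^ 2 * ν)) * (ν * (4 * Real.pi ^ 2 * freqNormSq k)) := by
    rw [show sobolevWeight 2 k = 1 + freqNormSq k by
      rw [sobolevWeight, div_self two_ne_zero, Real.rpow_one]]
    have h1 := Torus.one_le_freqNormSq hk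
    have : (1 / (2 * Real.pi ^ 2 * ν)) * (ν * (4 * Real.pi ^ 2 * freqNormSq k)) =
        2 * freqNormSq k := by
      field_simp
      ring
    rw [this]
    linarith
  -- assemble
  calc ENNReal.ofReal (sobolevWeight 2 k) * ‖c k‖ₑ
      ≤ ENNReal.ofReal ((1 / (2 * Real.pi ^ 2 * ν)) * (ν * (4 * Real.pi ^ 2 * freqNormSq k))) *
          ‖c k‖ₑ := mul_le_mul_left (ENNReal.ofReal_le_ofReal hw2) _
    _ = ENNReal.ofReal (1 / (2 * Real.pi ^ 2 * ν)) *
          (ENNReal.ofReal (ν * (4 * Real.pi ^ 2 * freqNormSq k)) * ‖c k‖ₑ) := by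
          rw [ENNReal.ofReal_mul (by positivity), mul_assoc]
    _ ≤ ENNReal.ofReal (1 / (2 * Real.pi ^ 2 * ν)) *
          (‖mFourierCoeff (EuclideanSpace.complexify ∘ f) k‖ₑ +
            ENNReal.ofReal (2 * Real.pi * (Fintype.card d : ℝ) ^ 2 * sobolevWeight 1 k) *
              ∑' l, ‖c (k - l)‖ₑ * ‖c l‖ₑ) := mul_le_mul_right (hE1.trans (add_le_add le_rfl hE2)) _
    _ ≤ ENNReal.ofReal (1 / (2 * Real.pi ^ 2 * ν)) *
          (ENNReal.ofReal (1 + 2 * Real.pi * (Fintype.card d : ℝ) ^ 2) *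
            (‖mFourierCoeff (EuclideanSpace.complexify ∘ f) k‖ₑ +
              ENNReal.ofReal (sobolevWeight 1 k) * ∑' l, ‖c (k - l)‖ₑ * ‖c l‖ₑ)) := by
          refine mul_le_mul_right ?_ _
          rw [mul_add]
          refine add_le_add ?_ ?_
          · exact le_mul_of_one_le_left (zero_le) (ENNReal.one_le_ofReal.2 (by
              nlinarith [Real.pi_pos, sq_nonneg (Fintype.card d : ℝ)]))
          · rw [← mul_assoc, ← ENNReal.ofReal_mul (by positivity)]
            refine mul_le_mul_left (ENNReal.ofReal_le_ofReal ?_) _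
            have := sobolevWeight_pos (1 : ℝ) k
            nlinarith
    _ = ENNReal.ofReal K * (‖mFourierCoeff (EuclideanSpace.complexify ∘ f) k‖ₑ +
          ENNReal.ofReal (sobolevWeight 1 k) * ∑' l, ‖c (k - l)‖ₑ * ‖c l‖ₑ) := by
          rw [← mul_assoc, ← ENNReal.ofReal_mul (by positivity), hK]
          congr 2
          field_simp

end DriftReg

/-! ## §2 The registered stub: regularity of drifted steady weak solutions on `T³` -/

/-- **Regularity of drifted steady weak solutions** (Temam 1979, Ch. II, Prop. 1.1, space-periodic
case, with a constant drift; stub `stub_driftRegularity` of the line `malkin-cone-group-orbits`,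
crux stmt-AnomalousDissipation-1144): for `ν > 0`, `f ∈ C^∞(T³; ℝ³)`, a constant drift `m ∈ ℝ³` and
`W ∈ V` with `⟨F(W), w⟩ + ∫ ⟪Dw(x) m, W(x)⟫ dx = 0` for every `w ∈ 𝒱`, the velocity `W` is a.e.
equal to a `C^∞` vector field.  Proof: the drifted coefficient inequality
`DriftReg.weight_two_mul_enorm_coeff_le_drift` (the drift term vanishes on the diagonal), the
lattice bootstrap `SteadyNS.tsum_weight_mul_ne_top` (rapid decay of `Ŵ`, `#(Fin 3) = 3 ≤ 3`), and
Fourier synthesis (`Torus.RapidDecay.isSmooth_fourierSynth`, `Torus.ae_eq_of_forall_mFourierCoeff_eq`);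
the real part of the synthesis is the smooth representative. [cite: Temam1979, Ch. II Prop. 1.1] -/
theorem stub_driftRegularity : ∀ (ν : ℝ) (m : EuclideanSpace ℝ (Fin 3)) (f : UnitAddTorus (Fin 3) → EuclideanSpace ℝ (Fin 3))
    (W : energySpace (Fin 3)), 0 < ν → IsSmooth f → W.1 ∈ energySpaceV (Fin 3) →
    (∀ w : UnitAddTorus (Fin 3) → EuclideanSpace ℝ (Fin 3), IsSmooth w → IsDivFree w → HasZeroMean w →
      Torus.nsGeneratorPairing ν f W w +
        ∫ x, ⟪Torus.fderiv w x m, (W.1 : UnitAddTorus (Fin 3) → EuclideanSpace ℝ (Fin 3)) x⟫_ℝ = 0) →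
    ∃ v : UnitAddTorus (Fin 3) → EuclideanSpace ℝ (Fin 3), IsSmooth v ∧
      (W.1 : UnitAddTorus (Fin 3) → EuclideanSpace ℝ (Fin 3)) =ᵐ[volume] v := by
  intro ν m f W hν hf hV hW
  set V : UnitAddTorus (Fin 3) → EuclideanSpace ℝ (Fin 3) :=
    (W.1 : UnitAddTorus (Fin 3) → EuclideanSpace ℝ (Fin 3)) with hVdef
  have hV2 : MemLp V 2 volume := Lp.memLp W.1
  have hVi : Integrable V volume := hV2.integrable one_le_two
  set c : (Fin 3 → ℤ) → EuclideanSpace ℂ (Fin 3) :=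
    fun k => mFourierCoeff (EuclideanSpace.complexify ∘ V) k with hcdef
  -- rapid decay of the Fourier coefficients of `W`
  have hrd : RapidDecay c := by
    refine SteadyNS.rapidDecay_of_tsum_weight_mul_enorm_ne_top fun n => ?_
    exact SteadyNS.tsum_weight_mul_ne_top (A := fun k => ‖c k‖ₑ)
      (F := fun k => ‖mFourierCoeff (EuclideanSpace.complexify ∘ f) k‖ₑ)
      (C := ENNReal.ofReal ((1 + 2 * Real.pi * (Fintype.card (Fin 3) : ℝ) ^ 2) /
        (2 * Real.pi ^ 2 * ν)))
      ENNReal.ofReal_ne_top (SteadyNS.tsum_weight_mul_enorm_ne_top_of_isSmooth hf.complexify_comp)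
      (DriftReg.weight_two_mul_enorm_coeff_le_drift hν hf hW) (by simp)
      (SteadyNS.tsum_weight_two_mul_enorm_sq_ne_top hV.2) n
  -- the smooth representative: the real part of the Fourier synthesis
  refine ⟨fun x => EuclideanSpace.realPart (fourierSynth c x), ?_, ?_⟩
  · exact hrd.isSmooth_fourierSynth.comp_clm EuclideanSpace.realPart
  · have hae : (EuclideanSpace.complexify ∘ V) =ᵐ[volume] fourierSynth c :=
      ae_eq_of_forall_mFourierCoeff_eq (integrable_complexify_comp hVi)
        hrd.isSmooth_fourierSynth.integrable fun k => (hrd.mFourierCoeff_fourierSynth k).symm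
    filter_upwards [hae] with x hx
    rw [← hx, Function.comp_apply, EuclideanSpace.realPart_complexify]

end Summit.AnomalousDissipation.AnomalousDissipation.Theorems.RobustLoudUpgrade.Category
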